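import Summits.ResolutionOfSingularities.ResolutionOfSingularities.Theorems.WeightedInvariantWeightedConstructionHullUscToolkit
import Mathlib.AlgebraicGeometry.Noetherian
import Mathlib.Topology.NoetherianSpace
import Mathlib.Topology.Sober
import HarnessLib

/-!
# Crux `WeightedConstruction`, line `pointwise-lexmax-hull`: stub `stub_hullUsc` — the reductions are tight

Route `ResolutionOfSingularities/WeightedInvariant`, crux `WeightedConstruction`
(stmt-ResolutionOfSingularities-0571), line `pointwise-lexmax-hull`, stub `stub_hullUsc`. [OURS · L1 w43]

Companion to `…HullUscToolkit.lean` (p459633) / `…HullUscGenericValue.lean` (p460524), which reduce the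
stub to statements about the generic value `gen` / the pointwise invariant `plex`. Here:

* `exists_finite_genDominating_of_isClosed_superlevel`, `isClosed_genHull_superlevel_iff` — on a
  NOETHERIAN quasi-sober space the sufficient condition of `isClosed_genHull_superlevel` is also
  NECESSARY: a superlevel set `{y ∈ Sing | γ ≤ hull y}` of the hull is closed IFF it is dominated by a
  finite family of singular points `η₀` with `γ ≤ gen η₀`. So clause `(usc)` of the stub is EXACTLY a
  per-threshold finiteness (constructibility) statement about `gen` — no slack in the reduction. (A single
  finite family for all `γ`, as in `isClosed_genHull_superlevel_of_finite`, is stronger: `(usc)` alone does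
  not bound the number of values of the hull.)
* `isClosed_superlevel_genHull_xSing_iff` — the same for the skeleton's singular locus `XSing` on a
  scheme of finite type over a field (Noetherian, quasi-sober).
* `IsGreatest.eq_of_subset_of_forall_exists_le` — the order-theoretic shape of the smooth-functoriality
  residue (B2'): if the admissible set downstairs embeds into the one upstairs (`s ⊆ t`, pull-back of
  charts) and every element upstairs is dominated by one downstairs, the greatest elements agree. (The two
  admissible SETS differ in general — `(2,3,3)` is admissible for `x²+y³` on `𝔸³` but not on `𝔸²` — so
  only this greatest-element form of (B2') is viable.)

No new mathematics; NOT a statement of the manuscript under review.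
-/

set_option linter.dupNamespace false -- mandated namespace of this single-conjunct summit

open CategoryTheory CategoryTheory.Limits AlgebraicGeometry TopologicalSpace Topology

namespace Summit.ResolutionOfSingularities.ResolutionOfSingularities.Theorems

universe u v w

section Order

variable {α : Type w} [PartialOrder α]

/-- **Greatest elements agree under embedding + domination.** If `s ⊆ t` and every `b ∈ t` is `≤` some
`a ∈ s`, then a greatest element of `t` equals a greatest element of `s`. (Shape of residue (B2'):
`s` = admissible profiles downstairs, `t` = admissible profiles upstairs.) [folklore] -/
theorem IsGreatest.eq_of_subset_of_forall_exists_le {s t : Set α} {a b : α} (hst : s ⊆ t)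
    (hdom : ∀ b' ∈ t, ∃ a' ∈ s, b' ≤ a') (ha : IsGreatest s a) (hb : IsGreatest t b) : b = a := by
  refine le_antisymm ?_ (hb.2 (hst ha.1))
  obtain ⟨a', ha', hba'⟩ := hdom b hb.1
  exact hba'.trans (ha.2 ha')

end Order

section Topology

variable {Y : Type v} [TopologicalSpace Y] {α : Type w}

/-- **`(usc)` forces finite domination (Noetherian quasi-sober spaces).** If the superlevel set
`{y ∈ Sing | γ ≤ hull y}` is closed, it is the union of finitely many irreducible closed sets; the generic
point `η_t` of each lies in it, so `γ ≤ hull η_t = gen η'_t` for some singular `η'_t ⤳ η_t`, and the finite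
family of the `η'_t` dominates the superlevel set. [folklore] -/
theorem exists_finite_genDominating_of_isClosed_superlevel [NoetherianSpace Y] [QuasiSober Y]
    [Preorder α] {S : Y → Prop} {gen hull : Y → α}
    (hhull : ∀ y, S y → IsGreatest {π | ∃ η : Y, η ⤳ y ∧ S η ∧ π = gen η} (hull y))
    (γ : α) (hcl : IsClosed {y | S y ∧ γ ≤ hull y}) :
    ∃ F : Set Y, F.Finite ∧ (∀ η₀ ∈ F, S η₀ ∧ γ ≤ gen η₀) ∧
      ∀ y, S y → γ ≤ hull y → ∃ η₀ ∈ F, η₀ ⤳ y := by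
  obtain ⟨T, hTfin, hTcl, hTirr, hTeq⟩ := NoetherianSpace.exists_finite_set_isClosed_irreducible hcl
  have key : ∀ t ∈ T, ∃ η₀ : Y, (S η₀ ∧ γ ≤ gen η₀) ∧ ∀ y ∈ t, η₀ ⤳ y := by
    intro t ht
    have hgp := (hTirr t ht).isGenericPoint_genericPoint (hTcl t ht)
    have hmem : (hTirr t ht).genericPoint ∈ {y | S y ∧ γ ≤ hull y} := by
      rw [hTeq]
      exact Set.mem_sUnion.mpr ⟨t, ht, hgp.mem⟩
    obtain ⟨hSη, hγ⟩ := hmem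
    obtain ⟨η', hη'η, hSη', heq⟩ := exists_genHull_eq hhull hSη
    exact ⟨η', ⟨hSη', hγ.trans_eq heq⟩, fun y hy => hη'η.trans (hgp.specializes hy)⟩
  choose φ hφ using key
  haveI : Finite ↥T := hTfin.to_subtype
  refine ⟨Set.range fun t : ↥T => φ t.1 t.2, Set.finite_range _, ?_, fun y hy hγ => ?_⟩
  · rintro _ ⟨t, rfl⟩
    exact (hφ t.1 t.2).1
  · have hmem : y ∈ ⋃₀ T := by
      rw [← hTeq]
      exact ⟨hy, hγ⟩
    obtain ⟨t, ht, hyt⟩ := Set.mem_sUnion.mp hmem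
    exact ⟨φ t ht, ⟨⟨t, ht⟩, rfl⟩, (hφ t ht).2 y hyt⟩

/-- **`(usc)` ⇔ per-threshold finite domination** (Noetherian quasi-sober space, singular locus
closed): `{y ∈ Sing | γ ≤ hull y}` is closed iff a finite family of singular `η₀` with `γ ≤ gen η₀`
dominates it. [folklore] -/
theorem isClosed_genHull_superlevel_iff [NoetherianSpace Y] [QuasiSober Y] [Preorder α]
    {S : Y → Prop} {gen hull : Y → α}
    (hhull : ∀ y, S y → IsGreatest {π | ∃ η : Y, η ⤳ y ∧ S η ∧ π = gen η} (hull y))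
    (hS : IsClosed {y | S y}) (γ : α) :
    IsClosed {y | S y ∧ γ ≤ hull y} ↔
      ∃ F : Set Y, F.Finite ∧ (∀ η₀ ∈ F, S η₀ ∧ γ ≤ gen η₀) ∧
        ∀ y, S y → γ ≤ hull y → ∃ η₀ ∈ F, η₀ ⤳ y :=
  ⟨exists_finite_genDominating_of_isClosed_superlevel hhull γ,
    fun ⟨_, hfin, hF, hdom⟩ => isClosed_genHull_superlevel hhull hS γ hfin hF hdom⟩

end Topology

/-! ## Scheme-level form with the skeleton's `XSing` -/

/-- **`(usc)` ⇔ per-threshold finite domination, for `XSing` on a scheme of finite type over a field.**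
`Y` is Noetherian (locally of finite type over a field and quasi-compact) and quasi-sober, the singular
locus is closed (`stub_isClosed_singularLocus`); so a superlevel set of a hull over `XSing` is closed iff it
is finitely `gen`-dominated — the exact content of clause `(usc)` of `stub_hullUsc`. [folklore] -/
theorem isClosed_superlevel_genHull_xSing_iff {α : Type w} [Preorder α] ⦃k : Type⦄ [Field k]
    ⦃Y : Scheme.{0}⦄ (f : Y ⟶ Spec (.of k)) [LocallyOfFiniteType f] [QuasiCompact f]
    (X : Y.IdealSheafData) {gen hull : Y → α}
    (hhull : ∀ y : Y, (∃ x : X.subscheme, X.subschemeι x = y ∧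
        ¬ IsRegularLocalRing (X.subscheme.presheaf.stalk x)) →
      IsGreatest {π | ∃ η : Y, η ⤳ y ∧ (∃ x : X.subscheme, X.subschemeι x = η ∧
        ¬ IsRegularLocalRing (X.subscheme.presheaf.stalk x)) ∧ π = gen η} (hull y))
    (γ : α) :
    IsClosed {y : Y | (∃ x : X.subscheme, X.subschemeι x = y ∧
        ¬ IsRegularLocalRing (X.subscheme.presheaf.stalk x)) ∧ γ ≤ hull y} ↔
      ∃ F : Set Y, F.Finite ∧
        (∀ η₀ ∈ F, (∃ x : X.subscheme, X.subschemeι x = η₀ ∧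
          ¬ IsRegularLocalRing (X.subscheme.presheaf.stalk x)) ∧ γ ≤ gen η₀) ∧
        ∀ y : Y, (∃ x : X.subscheme, X.subschemeι x = y ∧
          ¬ IsRegularLocalRing (X.subscheme.presheaf.stalk x)) → γ ≤ hull y → ∃ η₀ ∈ F, η₀ ⤳ y := by
  haveI : IsLocallyNoetherian Y := LocallyOfFiniteType.isLocallyNoetherian f
  haveI : CompactSpace ↥(Spec (CommRingCat.of k)) := inferInstance
  haveI : CompactSpace Y := QuasiCompact.compactSpace_of_compactSpace f
  haveI : IsNoetherian Y := ⟨⟩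
  exact isClosed_genHull_superlevel_iff hhull (stub_isClosed_singularLocus f X) γ

end Summit.ResolutionOfSingularities.ResolutionOfSingularities.Theorems
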